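import Summits.Ventures.DiscreteObjects.Hadamard.CompositeOrderTable

/-!
# Hadamard 668 census, family F12 — no automorphism of H(668) of order p² for p ∈ {11, 13, 23, 37, 41, 83, 167} (kernel)

Framing: lottery ticket; floor = certified bounds/negative ranges.

Cell pub-namedobj (venture DiscreteObjects), target (H), hadamard gen 11.  Prime-SQUARE orders.  If the permutation pair `(π, κ)` of
a signed automorphism of a Hadamard matrix of order `668` had order `p²`, then (power trick, re-signing) `κ^(p²) = 1` with `κ^p ≠ 1`
or `π^p ≠ 1`; the columns MOVED by `κ^p` form a `κ`-stable set on which `κ` acts freely with `κ^(p²) = 1` (a point fixed by `κ^k`,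
`0 < k < p²`, would be fixed by `κ^p`), so their number is a multiple of `p²` (`dvd_card_of_free`, induction on the orbit
decomposition of `FreeOrbits`); but it is `668 − #Fix(κ^p)` with `#Fix(κ^p)` in the kernel window / table for the prime `p`:
`{8,30,52}` (11), `44` (13), `{1,24}` (23), `2, 12, 4, 0` (37, 41, 83, 167) — never `≡ 668 (mod p²)`.  Hence
**`hadamard668_signedAut_not_dvd_orderOf_sq`**: `p² ∤ orderOf (π, κ)` for these seven primes (open by this count: `9, 25, 49`).
Ours, not literature; no `sorry`.
-/

namespace Summit.Ventures.DiscreteObjects.Hadamard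

open Finset BigOperators Matrix

open Literature.Combinatorics.Designs.GoethalsSeidel (IsHadamardMatrix)

variable {ι : Type*} [Fintype ι] [DecidableEq ι]

omit [Fintype ι] in
/-- **A finite set carrying a free action of `κ` with `κ^n = 1` has cardinality divisible by `n`.** -/
lemma dvd_card_of_free (κ : Equiv.Perm ι) {n : ℕ} (hn : 0 < n) (hκ : κ ^ n = 1) :
    ∀ (N : ℕ) (Y : Finset ι), Y.card ≤ N → (∀ y ∈ Y, κ y ∈ Y) →
      (∀ y ∈ Y, ∀ k, 0 < k → k < n → (κ ^ k) y ≠ y) → n ∣ Y.card := by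
  intro N
  induction N with
  | zero =>
    intro Y hY _ _
    rw [Nat.le_zero.mp hY]; exact dvd_zero n
  | succ N ih =>
    intro Y hY hstab hfree
    rcases Y.eq_empty_or_nonempty with hYe | ⟨y, hy⟩
    · rw [hYe, Finset.card_empty]; exact dvd_zero n
    · have hO : orbFin κ n y ⊆ Y := orbFin_subset_of_stable Y hstab hy
      have hOc : (orbFin κ n y).card = n := card_orbFin_of_free (hfree y hy)
      have hcard : (Y \ orbFin κ n y).card + n = Y.card := by
        have h := Finset.card_sdiff_add_card_eq_card hO
        rw [hOc] at h
        exact h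
      -- the complement is stable and free
      have hstab' : ∀ z ∈ Y \ orbFin κ n y, κ z ∈ Y \ orbFin κ n y := by
        intro z hz
        rw [Finset.mem_sdiff] at hz ⊢
        refine ⟨hstab z hz.1, fun hκz => hz.2 ?_⟩
        -- κ z ∈ O ⇒ z = κ^(n-1) (κ z) ∈ O
        have e : z = (κ ^ (n - 1)) (κ z) := by
          rw [← Equiv.Perm.mul_apply, ← pow_succ, Nat.sub_add_cancel hn, hκ]; rfl
        rw [e]
        obtain ⟨i, -, hi⟩ := Finset.mem_image.mp hκz
        rw [← hi, ← Equiv.Perm.mul_apply, ← pow_add]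
        exact pow_apply_mem_orbFin κ hn hκ y _
      have hfree' : ∀ z ∈ Y \ orbFin κ n y, ∀ k, 0 < k → k < n → (κ ^ k) z ≠ z :=
        fun z hz => hfree z (Finset.mem_sdiff.mp hz).1
      have hlt : (Y \ orbFin κ n y).card ≤ N := by omega
      have := ih (Y \ orbFin κ n y) hlt hstab' hfree'
      rw [← hcard]
      exact dvd_add this (dvd_refl n)

omit [Fintype ι] [DecidableEq ι] in
/-- a point moved by `κ^p` is free for `κ` below `p²` (`p` prime, `κ^(p²) = 1`) -/
lemma free_of_moved_pow (κ : Equiv.Perm ι) {p : ℕ} (hp : p.Prime) (hκ : κ ^ (p * p) = 1) {y : ι} (hy : (κ ^ p) y ≠ y) :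
    ∀ k, 0 < k → k < p * p → (κ ^ k) y ≠ y := by
  intro k hk0 hk hfix
  by_cases hpk : p ∣ k
  · obtain ⟨k', rfl⟩ := hpk
    have hk' : 0 < k' ∧ k' < p := by
      constructor
      · rcases Nat.eq_zero_or_pos k' with h | h
        · subst h; simp at hk0
        · exact h
      · by_contra hc
        have : p * p ≤ p * k' := Nat.mul_le_mul_left p (not_lt.mp hc)
        omega
    have hcop : Nat.Coprime k' p :=
      Nat.Coprime.symm ((Nat.Prime.coprime_iff_not_dvd hp).mpr (Nat.not_dvd_of_pos_of_lt hk'.1 hk'.2))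
    have h1 : ((κ ^ p) ^ k') y = y := by rw [← pow_mul]; exact hfix
    have h2 : ((κ ^ p) ^ p) y = y := by rw [← pow_mul, hκ]; rfl
    exact hy (perm_fixed_of_pow_coprime (κ ^ p) hcop hp.one_lt h1 h2)
  · have hcop : Nat.Coprime k (p * p) :=
      Nat.Coprime.mul_right (Nat.Coprime.symm ((Nat.Prime.coprime_iff_not_dvd hp).mpr hpk))
        (Nat.Coprime.symm ((Nat.Prime.coprime_iff_not_dvd hp).mpr hpk))
    have hpp : 1 < p * p := Nat.one_lt_mul_iff.mpr ⟨hp.pos, hp.pos, Or.inl hp.one_lt⟩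
    have h1 : κ y = y := perm_fixed_of_pow_coprime κ hcop hpp hfix (by rw [hκ]; rfl)
    exact hy (perm_pow_apply_of_fixed κ h1 p)

/-- **`p²` divides the number of points moved by `κ^p`** when `κ^(p²) = 1`. -/
lemma sq_dvd_card_moved (κ : Equiv.Perm ι) {p : ℕ} (hp : p.Prime) (hκ : κ ^ (p * p) = 1) :
    p * p ∣ (univ.filter fun j => (κ ^ p) j ≠ j).card := by
  apply dvd_card_of_free κ (Nat.mul_pos hp.pos hp.pos) hκ _ _ le_rfl
  · intro y hy
    simp only [Finset.mem_filter, Finset.mem_univ, true_and] at hy ⊢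
    rw [pow_apply_comm κ p y]
    exact fun h => hy (κ.injective h)
  · intro y hy
    simp only [Finset.mem_filter, Finset.mem_univ, true_and] at hy
    exact free_of_moved_pow κ hp hκ hy

section main
variable {H : Matrix ι ι ℤ} {π κ : Equiv.Perm ι}

/-- **Prime squares, unsigned form.**  A permutation automorphism pair with `π^(p²) = κ^(p²) = 1` and `(π^p, κ^p) ≠ (1,1)` is
impossible for `p ∈ {11, 13, 23, 37, 41, 83, 167}`. -/
theorem no_unsignedAut_order_sq (hH : IsHadamardMatrix H) (hι : Fintype.card ι = 668)
    (hA : ∀ i j, H (π i) (κ j) = H i j) {p : ℕ}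
    (hp : p = 11 ∨ p = 13 ∨ p = 23 ∨ p = 37 ∨ p = 41 ∨ p = 83 ∨ p = 167)
    (hπ : π ^ (p * p) = 1) (hκ : κ ^ (p * p) = 1) (hne : π ^ p ≠ 1 ∨ κ ^ p ≠ 1) : False := by
  have hpp : p.Prime := by rcases hp with rfl | rfl | rfl | rfl | rfl | rfl | rfl <;> norm_num
  have hπp : (π ^ p) ^ p = 1 := by rw [← pow_mul]; exact hπ
  have hκp : (κ ^ p) ^ p = 1 := by rw [← pow_mul]; exact hκ
  have hdvd := sq_dvd_card_moved κ hpp hκ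
  have hsplit := Finset.card_filter_add_card_filter_not (s := (univ : Finset ι)) (fun j => (κ ^ p) j = j)
  rw [Finset.card_univ, hι] at hsplit
  have e : (univ.filter fun j => (κ ^ p) j ≠ j) = univ.filter fun j => ¬ (κ ^ p) j = j := rfl
  rw [e] at hdvd
  rcases hp with rfl | hp'
  · -- p = 11: window
    obtain ⟨-, -, -, -, w11⟩ := hadamard668_signedAut_colClasses_window hH hι (p := 11) (by norm_num) (π ^ 11) (κ ^ 11)
      _ _ (isSignedAut_pow_of_unsigned hA 11) hπp hκp hne
    obtain ⟨hlo, hhi⟩ := w11 rfl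
    have hcl := card_fixed_add_classes (κ ^ 11) (by norm_num : (11 : ℕ).Prime) hκp
    rw [hι] at hcl
    obtain ⟨c, hc⟩ := hdvd
    omega
  · have hp13 : 13 ≤ p := by omega
    obtain ⟨e1, d1⟩ := hadamard668_signedAut_fixedRows hH hι p hpp hp13 (π ^ p) (κ ^ p) _ _
      (isSignedAut_pow_of_unsigned hA p) hπp hκp hne
    rw [e1] at d1
    obtain ⟨c, hc⟩ := hdvd
    rcases d1 with ⟨rfl, h1⟩ | ⟨rfl, h1⟩ | ⟨rfl, h1⟩ | ⟨rfl, h1⟩ | ⟨rfl, h1⟩ | ⟨rfl, h1⟩ <;> omega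

/-- **Prime squares.**  For every signed automorphism `(π, κ, d, e)` of a Hadamard matrix of order `668` and
`p ∈ {11, 13, 23, 37, 41, 83, 167}`: `p²` does not divide the order of `(π, κ)`. -/
theorem hadamard668_signedAut_not_dvd_orderOf_sq (hH : IsHadamardMatrix H) (hι : Fintype.card ι = 668)
    (π κ : Equiv.Perm ι) (d e : ι → ℤ) (haut : IsSignedAut H π κ d e) {p : ℕ}
    (hp : p = 11 ∨ p = 13 ∨ p = 23 ∨ p = 37 ∨ p = 41 ∨ p = 83 ∨ p = 167)
    (hdvd : p * p ∣ orderOf ((π, κ) : Equiv.Perm ι × Equiv.Perm ι)) : False := by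
  have hpp : p.Prime := by rcases hp with rfl | rfl | rfl | rfl | rfl | rfl | rfl <;> norm_num
  obtain ⟨π', κ', d', e', haut', h1, h2, h3, -⟩ := exists_pow_of_dvd_orderOf haut hpp hpp hdvd
  have hodd : Odd (p * p) := Nat.odd_mul.mpr ⟨hpp.odd_of_ne_two (by omega), hpp.odd_of_ne_two (by omega)⟩
  obtain ⟨H', hH', hA⟩ := exists_unsigned_of_signedAut hH haut' hodd h1 h2
  exact no_unsignedAut_order_sq hH' hι hA hp h1 h2 h3

end main

end Summit.Ventures.DiscreteObjects.Hadamard
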